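import Summits.NavierStokesRegularity.NavierStokesRegularity.Theses.FilamentSkeletonRss
import Summits.NavierStokesRegularity.NavierStokesRegularity.Theorems.FilamentSkeletonRssSkeletonJ1GSplit

/-!
# Route `FilamentSkeletonRss` · crux `SkeletonJ1L` (stmt-NavierStokesRegularity-23296) · THE SPLIT GLUE (Variant A1L, rigid matched cores)
# `SkeletonJ1L ⇐ TangentSkeletonNearStraightL ∧ Clause13NearStraightL ∧ NormalBlockMatchedL` (sorry-free)
# = the glue item `SkeletonJ1LOfNearStraightParts` (stmt-NavierStokesRegularity-23323), CLOSED BY NAME in §3.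

PORT (DIRECTOR-NS dss_111 port P1; tenure ns-filament-repair-plan g23/g24 owed port (b); lane `ns-filament-19175-p1` g14) of §1 + §3 of the
BC3 skeleton of record `pub-ns-dss/filament-plan/lines/SkeletonJ1L/near_straight_newton_L.lean` (sha256 8bb59219ae90f628…, registered on
stmt-23296 by tenure g24, critic idea-crit-7 g4 registry check PASS 20:37:42Z) — itself the verbatim port of the certified retype kit
`Cruxes/SelectionBoxRJ/Lines/retype_A1L_kit.lean` (ns-idea-12 g6, sha16 66aa737d78a81db5) §SplitA1L, the ONE-CONJUNCT TWIN of the LANDED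
`Theorems/FilamentSkeletonRssSkeletonJ1GSplit.lean` (glue of the A1G split, item 28298 ✓).  The same text is refuter1 g14's candidate
`PartsCandidate.lean` attached on 23323.
Variant A1L swaps exactly one conjunct of the flat clause block: the core-area transport law `w·A′ = (3/2 − w′)·A + 4` becomes the RIGID MATCHED
CORE `1 ≤ KA·A(c_j)` + `A ≡ A(c_j)` on `‖X‖ ≤ 2R_b√(Γ log Γ)`; the piece predicates `Clause12J1G`, `Clause13J1G`, `NearStraightJ1G`,
`StraightDatum` and the landed general-position datum `straightDatumGP_exists` do not contain that conjunct and are IMPORTED BY NAME from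
the 1G split file.
Contents: §1 `J1LMatrix`, `FlatJ1L` (kit texts verbatim) and the structured children `…LS` with the certificates `route decl ↔ structured := Iff.rfl`
(these piece predicates are what the child ports — `NormalBlockMatchedL` (23322), `Clause13NearStraightL` (23321) — cite by name);
§3 the composition `skeletonJ1L_of_children` (real proof: constants threaded `Rb := min Rb₀ Rb₁`, `η := 1`, `Γ₂ := max Γ₂ (max Γ₀ Γ₁)`)
and the glue item BY NAME, `skeletonJ1LOfNearStraightParts_holds`.  No `sorry`, standard axioms.
HONEST FRAMING: MODEL-rung bookkeeping of an OPEN ∃-crux about a HYPOTHETICAL filament-type rotating-self-similar blow-up skeleton (negative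
side of the portfolio); the three children 23320 / 23321 / 23322 and the parent 23296 stay OPEN; nothing here proves, refutes or moves any
statement about Navier–Stokes regularity. [folklore]
-/

set_option linter.dupNamespace false

noncomputable section

namespace Summit.NavierStokesRegularity.NavierStokesRegularity.Theorems.FilamentSkeletonRssSkeletonJ1LSplit

open Set Function Filter MeasureTheory Real
open Literature.Analysis.FluidPDE
open Summit.NavierStokesRegularity.NavierStokesRegularity.Theses.FilamentSkeletonRss
open Summit.NavierStokesRegularity.NavierStokesRegularity.Theorems.FilamentSkeletonRssSkeletonJ1GSplit
  (Clause12J1G Clause13J1G NearStraightJ1G StraightDatum straightDatumGP_exists)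
open scoped InnerProductSpace Laplacian ContDiff Topology BigOperators

/-! ## 1. The matrix of `SkeletonJ1L`, its flat part, and the structured children (kit §SplitA1L texts verbatim) -/

/-- The matrix of the route decl `SkeletonJ1L` — everything after `∀ Γ ≥ Γ₂, ∃ data` — VERBATIM (kit §SplitA1L). [folklore] -/
def J1LMatrix (N : ℕ) (δ ρ K Λ a b cnd Rw Rb cg θ₀ KA Γ : ℝ) (γ : Fin N → ℝ) (α : ℝ) (X : Fin N → ℝ → EuclideanSpace ℝ (Fin 3))
    (w : Fin N → ℝ → ℝ) (c : Fin N → ℝ) (m n : Fin N → EuclideanSpace ℝ (Fin 3)) (Aa : Fin N → ℝ → ℝ) : Prop :=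
  ∀ (u:(Fin N → ℝ → EuclideanSpace ℝ (Fin 3)) → EuclideanSpace ℝ (Fin 3) → EuclideanSpace ℝ (Fin 3)) (v:EuclideanSpace ℝ (Fin 3) → EuclideanSpace ℝ (Fin 3)) (A:Fin N → (EuclideanSpace ℝ (Fin 3) →L[ℝ] EuclideanSpace ℝ (Fin 3))) (T:(Fin N → ℝ → EuclideanSpace ℝ (Fin 3)) → Fin N → ℝ → EuclideanSpace ℝ (Fin 3)), (∀ Z y, u Z y = ∑ k, (Γ*γ k/(4*Real.pi))•∫ σ:ℝ, ((‖y-Z k σ‖^2+Real.exp (-(1+Real.eulerMascheroniConstant-Real.log 2))*Aa k σ)^(3/2:ℝ))⁻¹•cross (deriv (Z k) σ) (y-Z k σ))→(∀ y, v y = u X y+(1/2:ℝ)•y-α•cross (EuclideanSpace.single 2 1) y)→(∀ j, A j = fderiv ℝ v (X j (c j)))→(∀ Z j τ, T Z j τ = (u Z (Z j τ)+(1/2:ℝ)•Z j τ-α•cross (EuclideanSpace.single 2 1) (Z j τ))-(⟪u Z (Z j τ)+(1/2:ℝ)•Z j τ-α•cross (EuclideanSpace.single 2 1) (Z j τ),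 deriv (Z j) τ⟫_ℝ/‖deriv (Z j) τ‖^2)•deriv (Z j) τ)→(α ≠ 0 ∧ (∀ j, γ j ≠ 0) ∧ (∀ j, ContDiff ℝ 2 (X j) ∧ Differentiable ℝ (w j)∧(∀ τ, ‖deriv (X j) τ‖ = 1)∧(∀ τ, ‖iteratedDeriv 2 (X j) τ‖*√Γ≤K) ∧ Tendsto (fun τ => ‖X j τ‖) (cocompact ℝ) atTop) ∧ (∀ j k, j ≠ k → ∀ τ σ, ρ*√Γ≤‖X j τ-X k σ‖) ∧ (∀ j τ σ, ρ*√Γ≤|τ-σ| → cg*ρ*√Γ≤‖X j τ-X j σ‖) ∧ (∀ j τ, cg*|τ-c j|≤Rw*√Γ+‖X j τ‖) ∧ (∀ j τ, w j τ = ⟪v (X j τ), deriv (X j) τ⟫_ℝ) ∧ (∀ j τ, ‖X j τ‖≤Rb*√(Γ*Real.log Γ) → v (X j τ) = w j τ•deriv (X j) τ) ∧ (∀ j, ‖X j (c j)‖≤Rw*√Γ) ∧ (∀ j, |⟪deriv (X j) (c j), EuclideanSpace.single 2 1⟫_ℝ|≤1-θ₀) ∧ (θ₀≤|α| ∧ |α|≤θ₀⁻¹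 ∧ ∀ j, θ₀≤|γ j| ∧ |γ j|≤θ₀⁻¹) ∧ (∀ j, w j (c j) = 0 ∧ (∀ τ, w j τ = 0 → τ = c j) ∧ 3/2+δ≤deriv (w j) (c j) ∧ deriv (w j) (c j)≤Λ) ∧ (∀ j, Differentiable ℝ (Aa j) ∧ (∀ τ, 0 < Aa j τ) ∧ 1≤KA*Aa j (c j) ∧ ∀ τ, ‖X j τ‖≤2*Rb*√(Γ*Real.log Γ) → Aa j τ = Aa j (c j)) ∧ (∀ j τ, Rw^2*Γ*Aa j τ≤KA*(Rw^2*Γ+‖X j τ‖^2)) ∧ (∀ j, Orthonormal ℝ ![deriv (X j) (c j), m j, n j] ∧ ⟪A j (m j), m j⟫_ℝ+⟪A j (n j), n j⟫_ℝ < 0 ∧ ⟪A j (n j), m j⟫_ℝ * ⟪A j (m j), n j⟫_ℝ < ⟪A j (m j), m j⟫_ℝ * ⟪A j (n j), n j⟫_ℝ) ∧ (∀ Y:Fin N → ℝ → EuclideanSpace ℝ (Fin 3), (∀ j, ContDiff ℝ 2 (Y j))→(∀ j τ, ⟪Y j τ, deriv (X j) τ⟫_ℝ = 0) → (∀ j τ,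 Rb*√(Γ*Real.log Γ) < ‖X j τ‖ → Y j τ = 0) → ∑ j, ⟪Y j (c j), cross (EuclideanSpace.single 2 1) (X j (c j))⟫_ℝ = 0 → (∀ j τ, ‖Y j τ‖+‖deriv (Y j) τ‖+‖iteratedDeriv 2 (Y j) τ‖≤(1+|τ-c j|)^b) → ∀ L:ℝ, (∀ j τ, ‖deriv (fun s:ℝ => T (fun k σ => X k σ+s•Y k σ) j τ) 0‖≤L*(1+|τ-c j|)^a) → ∀ j τ, ‖Y j τ‖≤cnd*L*(1+|τ-c j|)^b))

/-- FLAT PART of the matrix: clauses 0–11, the RIGID matched core (the swapped conjunct) and the Γ-flat cone bound, verbatim. [folklore] -/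
def FlatJ1L (N : ℕ) (δ ρ K Λ Rw Rb cg θ₀ KA Γ : ℝ) (γ : Fin N → ℝ) (α : ℝ) (X : Fin N → ℝ → EuclideanSpace ℝ (Fin 3))
    (w : Fin N → ℝ → ℝ) (c : Fin N → ℝ) (Aa : Fin N → ℝ → ℝ) : Prop :=
  ∀ (u:(Fin N → ℝ → EuclideanSpace ℝ (Fin 3)) → EuclideanSpace ℝ (Fin 3) → EuclideanSpace ℝ (Fin 3)) (v:EuclideanSpace ℝ (Fin 3) → EuclideanSpace ℝ (Fin 3)) (A:Fin N → (EuclideanSpace ℝ (Fin 3) →L[ℝ] EuclideanSpace ℝ (Fin 3))) (T:(Fin N → ℝ → EuclideanSpace ℝ (Fin 3)) → Fin N → ℝ → EuclideanSpace ℝ (Fin 3)), (∀ Z y, u Z y = ∑ k, (Γ*γ k/(4*Real.pi))•∫ σ:ℝ, ((‖y-Z k σ‖^2+Real.exp (-(1+Real.eulerMascheroniConstant-Real.log 2))*Aa k σ)^(3/2:ℝ))⁻¹•cross (deriv (Z k) σ) (y-Z k σ))→(∀ y, v y = u X y+(1/2:ℝ)•y-α•cross (EuclideanSpace.single 2 1)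 y)→(∀ j, A j = fderiv ℝ v (X j (c j)))→(∀ Z j τ, T Z j τ = (u Z (Z j τ)+(1/2:ℝ)•Z j τ-α•cross (EuclideanSpace.single 2 1) (Z j τ))-(⟪u Z (Z j τ)+(1/2:ℝ)•Z j τ-α•cross (EuclideanSpace.single 2 1) (Z j τ), deriv (Z j) τ⟫_ℝ/‖deriv (Z j) τ‖^2)•deriv (Z j) τ)→(α ≠ 0 ∧ (∀ j, γ j ≠ 0) ∧ (∀ j, ContDiff ℝ 2 (X j) ∧ Differentiable ℝ (w j)∧(∀ τ, ‖deriv (X j) τ‖ = 1)∧(∀ τ, ‖iteratedDeriv 2 (X j) τ‖*√Γ≤K) ∧ Tendsto (fun τ => ‖X j τ‖) (cocompact ℝ) atTop) ∧ (∀ j k, j ≠ k → ∀ τ σ, ρ*√Γ≤‖X j τ-X k σ‖) ∧ (∀ j τ σ, ρ*√Γ≤|τ-σ| → cg*ρ*√Γ≤‖X j τ-X j σ‖) ∧ (∀ j τ, cg*|τ-c j|≤Rw*√Γ+‖X j τ‖) ∧ (∀ j τ, w j τ = ⟪v (X j τ), deriv (X j) τ⟫_ℝ) ∧ (∀ j τ,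 ‖X j τ‖≤Rb*√(Γ*Real.log Γ) → v (X j τ) = w j τ•deriv (X j) τ) ∧ (∀ j, ‖X j (c j)‖≤Rw*√Γ) ∧ (∀ j, |⟪deriv (X j) (c j), EuclideanSpace.single 2 1⟫_ℝ|≤1-θ₀) ∧ (θ₀≤|α| ∧ |α|≤θ₀⁻¹ ∧ ∀ j, θ₀≤|γ j| ∧ |γ j|≤θ₀⁻¹) ∧ (∀ j, w j (c j) = 0 ∧ (∀ τ, w j τ = 0 → τ = c j) ∧ 3/2+δ≤deriv (w j) (c j) ∧ deriv (w j) (c j)≤Λ) ∧ (∀ j, Differentiable ℝ (Aa j) ∧ (∀ τ, 0 < Aa j τ) ∧ 1≤KA*Aa j (c j) ∧ ∀ τ, ‖X j τ‖≤2*Rb*√(Γ*Real.log Γ) → Aa j τ = Aa j (c j)) ∧ (∀ j τ, Rw^2*Γ*Aa j τ≤KA*(Rw^2*Γ+‖X j τ‖^2)))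

/-- Child 1 `TangentSkeletonNearStraightL` (stmt-23320, XL, the heart), structured form over `FlatJ1L` / `NearStraightJ1G` / `StraightDatum`. (route-posited stub statement; not a Literature fact) -/
def TangentSkeletonNearStraightLS : Prop :=
  ∀ (N : ℕ) (δd ρd Λd Rwd θd mw : ℝ) (p t : Fin N → EuclideanSpace ℝ (Fin 3)) (γ : Fin N → ℝ) (α : ℝ) (s₀ : Fin N → ℝ),
    0 < N → 0 < δd → 0 < ρd → 0 < Rwd → 0 < θd → 0 < mw → StraightDatum N δd ρd Λd Rwd θd mw p t γ α s₀ →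
    (∀ j k, j ≠ k → |⟪t j, t k⟫_ℝ| ≤ 1 - θd) →
    ∃ (δ ρ K Λ Rw cg θ₀ KA Rb₁ : ℝ), 0 < δ ∧ 0 < ρ ∧ 0 < Rw ∧ 0 < cg ∧ 0 < θ₀ ∧ 0 < Rb₁ ∧
      2 * K * ρ ≤ 1 ∧ ∀ Rb : ℝ, 0 < Rb → Rb ≤ Rb₁ → ∃ Γ₂ : ℝ, ∀ Γ : ℝ, Γ₂ ≤ Γ →
        ∃ (X : Fin N → ℝ → EuclideanSpace ℝ (Fin 3)) (w : Fin N → ℝ → ℝ) (c : Fin N → ℝ) (Aa : Fin N → ℝ → ℝ),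
          FlatJ1L N δ ρ K Λ Rw Rb cg θ₀ KA Γ γ α X w c Aa ∧ NearStraightJ1G N Λ Rb X w Aa

/-- Child 2 `Clause13NearStraightL` (stmt-23321, M–L), structured form over `FlatJ1L` / `NearStraightJ1G` / `Clause13J1G`. (route-posited stub statement; not a Literature fact) -/
def Clause13NearStraightLS : Prop :=
  ∀ (N : ℕ) (δ ρ K Λ Rw cg θ₀ KA : ℝ), 0 < N → 0 < δ → 0 < ρ → 0 < Rw → 0 < cg → 0 < θ₀ →
    ∃ Rb₀ : ℝ, 0 < Rb₀ ∧ ∀ Rb : ℝ, 0 < Rb → Rb ≤ Rb₀ → ∃ (a b cnd Γ₀ : ℝ), 0 ≤ a ∧ 0 < cnd ∧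
      ∀ Γ : ℝ, Γ₀ ≤ Γ → ∀ (γ : Fin N → ℝ) (α : ℝ) (X : Fin N → ℝ → EuclideanSpace ℝ (Fin 3)) (w : Fin N → ℝ → ℝ)
        (c : Fin N → ℝ) (Aa : Fin N → ℝ → ℝ),
        FlatJ1L N δ ρ K Λ Rw Rb cg θ₀ KA Γ γ α X w c Aa → NearStraightJ1G N Λ Rb X w Aa →
          Clause13J1G N a b cnd Rb Γ γ α X w c Aa

/-- Child 3 `NormalBlockMatchedL` (stmt-23322, M), structured form over `FlatJ1L` / `NearStraightJ1G` / `Clause12J1G`. (route-posited stub statement; not a Literature fact) -/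
def NormalBlockMatchedLS : Prop :=
  ∀ (N : ℕ) (δ ρ K Λ Rw Rb cg θ₀ KA : ℝ), 0 < N → 0 < δ → 0 < ρ → 0 < Rw → 0 < Rb → 0 < cg → 0 < θ₀ →
    2 * K * ρ ≤ 1 → ∃ Γ₀ : ℝ, ∀ Γ : ℝ, Γ₀ ≤ Γ → ∀ (γ : Fin N → ℝ) (α : ℝ) (X : Fin N → ℝ → EuclideanSpace ℝ (Fin 3))
      (w : Fin N → ℝ → ℝ) (c : Fin N → ℝ) (Aa : Fin N → ℝ → ℝ),
      FlatJ1L N δ ρ K Λ Rw Rb cg θ₀ KA Γ γ α X w c Aa → NearStraightJ1G N Λ Rb X w Aa → Clause12J1G N Γ γ α X w c Aa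

/-- CERTIFICATE: the route decl `SkeletonJ1L` unfolds to `∃ consts, … ∀ Γ ≥ Γ₂, ∃ data, J1LMatrix …` by `Iff.rfl`. [folklore] -/
theorem skeletonJ1L_iff_matrix :
    Summit.NavierStokesRegularity.NavierStokesRegularity.Theses.FilamentSkeletonRss.SkeletonJ1L ↔ ∃ (N : ℕ) (δ ρ K Λ a b cnd η Rw Rb cg θ₀ KA Γ₂ : ℝ), 0 < N ∧ 0 < δ ∧ 0 < ρ ∧ 0 ≤ a ∧ 0 < cnd ∧
      0 < η ∧ 0 < Rw ∧ 0 < Rb ∧ 0 < cg ∧ 0 < θ₀ ∧ ∀ Γ : ℝ, Γ₂ ≤ Γ →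
        ∃ (γ : Fin N → ℝ) (α : ℝ) (X : Fin N → ℝ → EuclideanSpace ℝ (Fin 3)) (w : Fin N → ℝ → ℝ) (c : Fin N → ℝ)
          (m n : Fin N → EuclideanSpace ℝ (Fin 3)) (Aa : Fin N → ℝ → ℝ), J1LMatrix N δ ρ K Λ a b cnd Rw Rb cg θ₀ KA Γ γ α X w c m n Aa :=
  Iff.rfl

/-- CERTIFICATE: the route item `TangentSkeletonNearStraightL` (stmt-23320, fully inlined on the route) IS the structured child 1 (definitional). [folklore] -/
theorem route_tangentSkeletonNearStraightL_iff :
    Summit.NavierStokesRegularity.NavierStokesRegularity.Theses.FilamentSkeletonRss.TangentSkeletonNearStraightL ↔ TangentSkeletonNearStraightLS :=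
  Iff.rfl

/-- CERTIFICATE: the route item `Clause13NearStraightL` (stmt-23321) IS the structured child 2 (definitional). [folklore] -/
theorem route_clause13NearStraightL_iff :
    Summit.NavierStokesRegularity.NavierStokesRegularity.Theses.FilamentSkeletonRss.Clause13NearStraightL ↔ Clause13NearStraightLS :=
  Iff.rfl

/-- CERTIFICATE: the route item `NormalBlockMatchedL` (stmt-23322) IS the structured child 3 (definitional). [folklore] -/
theorem route_normalBlockMatchedL_iff :
    Summit.NavierStokesRegularity.NavierStokesRegularity.Theses.FilamentSkeletonRss.NormalBlockMatchedL ↔ NormalBlockMatchedLS :=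
  Iff.rfl

/-! ## 3. Composition: the three children imply the crux `SkeletonJ1L`, BY NAME (real proof) -/

/-- COMPOSITION through the matrix (kit `skeletonJ1L_matrix_of_pieces` verbatim): constants threaded `Rb := min Rb₀ Rb₁`, `η := 1`,
`Γ₂ := max Γ₂ (max Γ₀ Γ₁)`; the flat clauses, clause 12 and clause 13-J re-assembled in the crux's order. [folklore] -/
theorem skeletonJ1L_matrix_of_pieces (h2 : TangentSkeletonNearStraightLS) (h3 : Clause13NearStraightLS)
    (h4 : NormalBlockMatchedLS) :
    ∃ (N : ℕ) (δ ρ K Λ a b cnd η Rw Rb cg θ₀ KA Γ₂ : ℝ), 0 < N ∧ 0 < δ ∧ 0 < ρ ∧ 0 ≤ a ∧ 0 < cnd ∧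
      0 < η ∧ 0 < Rw ∧ 0 < Rb ∧ 0 < cg ∧ 0 < θ₀ ∧ ∀ Γ : ℝ, Γ₂ ≤ Γ →
        ∃ (γ : Fin N → ℝ) (α : ℝ) (X : Fin N → ℝ → EuclideanSpace ℝ (Fin 3)) (w : Fin N → ℝ → ℝ) (c : Fin N → ℝ)
          (m n : Fin N → EuclideanSpace ℝ (Fin 3)) (Aa : Fin N → ℝ → ℝ), J1LMatrix N δ ρ K Λ a b cnd Rw Rb cg θ₀ KA Γ γ α X w c m n Aa := by
  obtain ⟨N, δd, ρd, Λd, Rwd, θd, mw, p, t, γ, α, s₀, hN, hδ, hρ, hRw, hθ, hmw, hSD, hGP⟩ := straightDatumGP_exists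
  obtain ⟨δ', ρ', K, Λ', Rw', cg, θ₀', KA, Rb₁, hδ', hρ', hRw', hcg, hθ₀', hRb₁, hKρ, hfam⟩ :=
    h2 N δd ρd Λd Rwd θd mw p t γ α s₀ hN hδ hρ hRw hθ hmw hSD hGP
  obtain ⟨Rb₀, hRb₀, h13⟩ := h3 N δ' ρ' K Λ' Rw' cg θ₀' KA hN hδ' hρ' hRw' hcg hθ₀'
  have hRb : 0 < min Rb₀ Rb₁ := lt_min hRb₀ hRb₁
  obtain ⟨a, b, cnd, Γ₀, ha, hcnd, h13'⟩ := h13 (min Rb₀ Rb₁) hRb (min_le_left _ _)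
  obtain ⟨Γ₂, hfam'⟩ := hfam (min Rb₀ Rb₁) hRb (min_le_right _ _)
  obtain ⟨Γ₁, h12⟩ := h4 N δ' ρ' K Λ' Rw' (min Rb₀ Rb₁) cg θ₀' KA hN hδ' hρ' hRw' hRb hcg hθ₀' hKρ
  refine ⟨N, δ', ρ', K, Λ', a, b, cnd, 1, Rw', min Rb₀ Rb₁, cg, θ₀', KA, max Γ₂ (max Γ₀ Γ₁), hN, hδ', hρ', ha, hcnd,
    one_pos, hRw', hRb, hcg, hθ₀', ?_⟩
  intro Γ hΓ
  have hΓ₂ : Γ₂ ≤ Γ := le_trans (le_max_left _ _) hΓ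
  have hΓ₀ : Γ₀ ≤ Γ := le_trans (le_trans (le_max_left _ _) (le_max_right _ _)) hΓ
  have hΓ₁ : Γ₁ ≤ Γ := le_trans (le_trans (le_max_right _ _) (le_max_right _ _)) hΓ
  obtain ⟨X, w, c, Aa, hflat, hns⟩ := hfam' Γ hΓ₂
  have hc13 := h13' Γ hΓ₀ γ α X w c Aa hflat hns
  obtain ⟨m, n, hc12⟩ := h12 Γ hΓ₁ γ α X w c Aa hflat hns
  refine ⟨γ, α, X, w, c, m, n, Aa, ?_⟩
  intro u v A T hu hv hA hT
  obtain ⟨k0, k1, k2, k3, k4, k5, k6, k7, k8, k9, k10, k11, k12, k13⟩ := hflat u v A T hu hv hA hT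
  exact ⟨k0, k1, k2, k3, k4, k5, k6, k7, k8, k9, k10, k11, k12, k13, hc12 u v A T hu hv hA hT, hc13 u v A T hu hv hA hT⟩

/-- The split implication in structured form. [folklore] -/
theorem skeletonJ1L_of_pieces (h2 : TangentSkeletonNearStraightLS) (h3 : Clause13NearStraightLS) (h4 : NormalBlockMatchedLS) :
    Summit.NavierStokesRegularity.NavierStokesRegularity.Theses.FilamentSkeletonRss.SkeletonJ1L :=
  skeletonJ1L_iff_matrix.mpr (skeletonJ1L_matrix_of_pieces h2 h3 h4)

/-- **THE GLUE OF THE SPLIT over the route items**: the three children (route decls, by fully qualified name) imply the parent crux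
`SkeletonJ1L` (= the statement of the glue item `SkeletonJ1LOfNearStraightParts`, stmt-23323, up to `Iff.rfl`). [folklore] -/
theorem skeletonJ1L_of_children (h2 : Summit.NavierStokesRegularity.NavierStokesRegularity.Theses.FilamentSkeletonRss.TangentSkeletonNearStraightL)
    (h3 : Summit.NavierStokesRegularity.NavierStokesRegularity.Theses.FilamentSkeletonRss.Clause13NearStraightL) (h4 : Summit.NavierStokesRegularity.NavierStokesRegularity.Theses.FilamentSkeletonRss.NormalBlockMatchedL) :
    Summit.NavierStokesRegularity.NavierStokesRegularity.Theses.FilamentSkeletonRss.SkeletonJ1L :=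
  skeletonJ1L_of_pieces (route_tangentSkeletonNearStraightL_iff.mp h2) (route_clause13NearStraightL_iff.mp h3)
    (route_normalBlockMatchedL_iff.mp h4)

/-- **The route's glue item `FilamentSkeletonRss.SkeletonJ1LOfNearStraightParts` (stmt-NavierStokesRegularity-23323) BY NAME**:
`TangentSkeletonNearStraightL → Clause13NearStraightL → NormalBlockMatchedL → SkeletonJ1L` (children ⟹ parent). [folklore] -/
theorem skeletonJ1LOfNearStraightParts_holds :
    Summit.NavierStokesRegularity.NavierStokesRegularity.Theses.FilamentSkeletonRss.SkeletonJ1LOfNearStraightParts :=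
  fun h2 h3 h4 => skeletonJ1L_of_children h2 h3 h4

end Summit.NavierStokesRegularity.NavierStokesRegularity.Theorems.FilamentSkeletonRssSkeletonJ1LSplit

end
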